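import Literature.NumberTheory.EllipticCurves.BoxerDiao2010.TamagawaTwistLocalProofs
import Literature.NumberTheory.EllipticCurves.TamagawaRingEquivProofs
import Mathlib.NumberTheory.Padics.RingHoms
import Mathlib.NumberTheory.Padics.HeightOneSpectrum
import HarnessLib

/-!
# The Mordell curves `y² = x³ + k`: the local Tamagawa number on the three rows of type `I₀*`
# (`p ≥ 5` with `v_p(k) ≡ 3 (mod 6)`; `p = 2` with `v₂(k) ≡ 3`, or `v₂(k) ≡ 2 (mod 6)` and
# `k/2^{v₂(k)} ≡ 3 (mod 4)`), by Step 6 of Tate's algorithm run in the kernel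

`Proofs`-style file (THEOREMS ONLY: no definition, no named fact, no instance), topic
`Literature/NumberTheory/EllipticCurves`. Cell `bsd-print-cf2`, seat ty2 (discharge interface of the
line `route-BirchSwinnertonDyer-CMKolyvaginAtInertTwo`, whose habitat `H₂` carries the binder
`Odd W.tamagawaProduct` on the `j = 0` class); HONEST FRAMING: a textbook local computation, nothing
about BSD is asserted or booked. Companion of `MordellCurveKodairaThreeProofs` (the place `3`) and of
the tree's `MordellCurveTateAlgorithmTwoProofs` / X12's
`hasGoodReductionAt_or_kodairaSymbolAt_of_mordell` (Kodaira symbols at `2` and at `p ≥ 5`), which give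
the symbol `I₀*` on these rows but not the component count.

## The printed statement and the proof followed

Silverman, *ATAEC* IV.9.4 Step 6 (PDF p. 345): on the normal form `π ∣ a₁, a₂`, `π² ∣ a₃, a₄`,
`π³ ∣ a₆` with separable cubic `P(T) = T³ + a_{2,1}T² + a_{4,2}T + a_{6,3}`, the type is `I₀*` and
`c = 1 + #{α ∈ k : P(α) = 0}`. The tree's Hensel-light form of this (Boxer–Diao 2010, proof of
Prop. 4.1; `LocalIndex.localTamagawaNumber_baseChange_eq_one_of_cubic_no_root`,
`LocalIndex.two_dvd_localTamagawaNumber_baseChange_of_cubic_simple_root`): no root of `P̄` in `k`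
⇒ `c = 1`; a SIMPLE root ⇒ `2 ∣ c`. For `y² = x³ + p³u`, `p ∤ u`, the equation IS the normal form
(`ϖ = p`, `P(T) = T³ + u`), minimal since `v_p(Δ) = v_p(−432p⁶u²) = 6 < 12` for `p ≥ 5`:

* `p ≥ 5`: `P̄ = T³ + ū` is separable (`p ∤ 3u`); it has a root in `𝔽_p` iff `−u`, i.e. `u`, is a
  cube mod `p` (always for `p ≡ 2 (mod 3)`), and every root is simple. So **`c_p = 1` if `u` is a
  cubic non-residue mod `p`, and `2 ∣ c_p` (indeed `c_p ∈ {2, 4}`) if `u` is a cube mod `p`**.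
* `p = 2`, `k = 8u`, `u` odd: `P̄ = T³ + 1 = (T + 1)(T² + T + 1)` over `𝔽₂`, simple root `T = 1`:
  **`2 ∣ c₂`** (`v₂(Δ) = 10`).
* `p = 2`, `k = 4u`, `u ≡ 3 (mod 4)`: after `y ↦ y + 2` the equation `y² + 4y = x³ + 4(u − 1)` is the
  normal form (`a₃ = 2²·1`, `a₆ = 2³·(u−1)/2` with `(u−1)/2` odd), `P̄ = T³ + 1` again: **`2 ∣ c₂`**
  (`v₂(Δ) = 8`).

(At `2` the residue field is `𝔽₂`, so `c₂ = 4` is impossible and these rows have `c₂ = 2`; only the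
parity is recorded here.) Each statement is given for the `p`-adic local Tamagawa number
`(W ⊗ ℚ_p).localTamagawaNumber ℤ_p` of ANY model `W` of `y² = x³ + k` (`C • W = (0,0,0,0,k)`,
`k = pᵃu` arbitrary with the stated `a mod 6`, reduced by the rescaling `(p^m, 0, 0, 0)`), and at the
place `v ∣ p` of `ℚ` (`localTamagawaNumber_padic_eq_holds`), the currency of `W.tamagawaProduct`.

## References

* J. H. Silverman, *Advanced Topics in the Arithmetic of Elliptic Curves*, GTM 151, Springer 1994,
  IV.9.4 Step 6 (PDF p. 345) and Table 4.1. [SilvermanATAEC1994]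
* G. Boxer, P. Diao, *2-Selmer groups of quadratic twists of elliptic curves*, Proc. AMS 138 (2010)
  1969–1978, proof of Prop. 4.1 (p. 1977: "`c_p` is equal to `1` plus the number of roots …").
  [BoxerDiao2010]
* J. H. Silverman, *The Arithmetic of Elliptic Curves*, 2nd ed. (2009), VII.1 Rem. 1.1 (minimality
  from `v(Δ) < 12`), VII.6 Ex. 7.6 (model independence of `c_p`). [SilvermanAEC2009]
-/

set_option autoImplicit false

noncomputable section

open scoped Classical NumberField

open IsLocalRing WeierstrassCurve NumberField IsDedekindDomain Rat.HeightOneSpectrum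
  Literature.NumberTheory.EllipticCurves

namespace Literature.NumberTheory.EllipticCurves.Mordell

/-! ## §0 `ℤ_p` helpers -/

section Helpers

variable {p : ℕ} [hp : Fact p.Prime]

/-- `ℤ_p` is Henselian (it is `p`-adically complete). [folklore] -/
private theorem henselianLocalRing_padicInt' : HenselianLocalRing ℤ_[p] :=
  { is_henselian := fun f hf a₀ h₁ h₂ =>
      HenselianRing.is_henselian (I := IsLocalRing.maximalIdeal ℤ_[p]) f hf a₀ h₁ (h₂.map _) }

/-- An integer prime to `p` is a unit of `ℤ_p`. [folklore] -/
private theorem isUnit_intCast_padicInt_of_not_dvd {z : ℤ} (h : ¬ (p : ℤ) ∣ z) :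
    IsUnit (z : ℤ_[p]) := by
  rw [PadicInt.isUnit_iff]
  exact le_antisymm (PadicInt.norm_le_one _)
    (not_lt.mp fun hlt => h ((PadicInt.norm_int_lt_one_iff_dvd z).mp hlt))

/-- An integer prime to `p` is non-zero in the residue field of `ℤ_p`. [folklore] -/
private theorem intCast_residueField_ne_zero {z : ℤ} (h : ¬ (p : ℤ) ∣ z) :
    residue ℤ_[p] (z : ℤ_[p]) ≠ 0 := by
  rw [residue_ne_zero_iff_isUnit]
  exact isUnit_intCast_padicInt_of_not_dvd h

/-- The residue of an integer `z ∈ ℤ_p`, read in `ZMod p` along `PadicInt.residueField`, is `z mod p`.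
[folklore] -/
private theorem residueField_residue_intCast (z : ℤ) :
    PadicInt.residueField (residue ℤ_[p] (z : ℤ_[p])) = (z : ZMod p) := by
  rw [map_intCast, map_intCast]

/-- `p ∤ z` for a prime `p` different from the primes `q₁, q₂` when `z ∣ q₁^a q₂^b`… in the form used
here: `p ≠ 2, 3` ⇒ `p ∤ 432 = 2⁴3³`. [folklore] -/
private theorem not_dvd_432 (hp2 : p ≠ 2) (hp3 : p ≠ 3) : ¬ (p : ℤ) ∣ 432 := by
  intro h
  have hp' : Prime (p : ℤ) := Nat.prime_iff_prime_int.mp hp.out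
  have h' : (p : ℤ) ∣ 2 ^ 4 * 3 ^ 3 := by norm_num; exact h
  rcases hp'.dvd_or_dvd h' with h | h
  · have h2 : (p : ℤ) ∣ 2 := hp'.dvd_of_dvd_pow h
    exact hp2 ((Nat.prime_dvd_prime_iff_eq hp.out Nat.prime_two).mp (by exact_mod_cast h2))
  · have h3 : (p : ℤ) ∣ 3 := hp'.dvd_of_dvd_pow h
    exact hp3 ((Nat.prime_dvd_prime_iff_eq hp.out Nat.prime_three).mp (by exact_mod_cast h3))

end Helpers

/-! ## §1 Over `ℤ_p`, `p ≥ 5`: the model `y² = x³ + p³u`, `p ∤ u` -/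

section OddPrime

variable (p : ℕ) [hp : Fact p.Prime] (u : ℤ)

/-- `Δ(y² = x³ + p³u) = p⁶ · (−432u²)` in `ℤ_p`. [cite: SilvermanAEC2009, III.1 (formula for Δ)] -/
theorem Δ_cubeModel_padic :
    (⟨0, 0, 0, 0, (p : ℤ_[p]) ^ 3 * (u : ℤ_[p])⟩ : WeierstrassCurve ℤ_[p]).Δ =
      (p : ℤ_[p]) ^ 6 * ((-432 * u ^ 2 : ℤ) : ℤ_[p]) := by
  simp only [WeierstrassCurve.Δ, WeierstrassCurve.b₂, WeierstrassCurve.b₄, WeierstrassCurve.b₆,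
    WeierstrassCurve.b₈]
  push_cast; ring

variable {p u}

/-- The common part of Step 6 on `y² = x³ + p³u` (`p ≥ 5`, `p ∤ u`): the equation over `ℤ_p` is a
minimal (`v(Δ) = 6 < 12`) elliptic equation. [cite: SilvermanAEC2009, VII.1 Remark 1.1] -/
theorem isMinimal_cubeModel_padic (hp2 : p ≠ 2) (hp3 : p ≠ 3) (hu : ¬ (p : ℤ) ∣ u) :
    ((⟨0, 0, 0, 0, (p : ℤ_[p]) ^ 3 * (u : ℤ_[p])⟩ : WeierstrassCurve ℤ_[p]).baseChange ℚ_[p]).IsMinimal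
        ℤ_[p] ∧
      ((⟨0, 0, 0, 0, (p : ℤ_[p]) ^ 3 * (u : ℤ_[p])⟩ : WeierstrassCurve ℤ_[p]).baseChange
        ℚ_[p]).IsElliptic := by
  set N : WeierstrassCurve ℤ_[p] := ⟨0, 0, 0, 0, (p : ℤ_[p]) ^ 3 * (u : ℤ_[p])⟩ with hN
  have hp' : Prime (p : ℤ) := Nat.prime_iff_prime_int.mp hp.out
  have hunit : IsUnit (((-432 * u ^ 2 : ℤ)) : ℤ_[p]) := by
    refine isUnit_intCast_padicInt_of_not_dvd fun h => ?_
    rcases hp'.dvd_or_dvd h with h | h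
    · exact not_dvd_432 hp2 hp3 (by rwa [dvd_neg] at h)
    · exact hu (hp'.dvd_of_dvd_pow h)
  have hΔeq : N.Δ = (p : ℤ_[p]) ^ 6 * ((-432 * u ^ 2 : ℤ) : ℤ_[p]) := Δ_cubeModel_padic p u
  haveI : WeierstrassCurve.IsIntegral ℤ_[p] (N.baseChange ℚ_[p]) := ⟨⟨_, rfl⟩⟩
  have hval : (IsDiscreteValuationRing.maximalIdeal ℤ_[p]).valuation ℚ_[p] (N.baseChange ℚ_[p]).Δ =
      WithZero.exp (-(6 : ℕ) : ℤ) := by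
    rw [WeierstrassCurve.baseChange, WeierstrassCurve.map_Δ, hΔeq]
    exact LocalIndex.valuation_algebraMap_pow_mul_of_isUnit PadicInt.irreducible_p hunit 6
  have hmin : (N.baseChange ℚ_[p]).IsMinimal ℤ_[p] :=
    WeierstrassCurve.isMinimal_of_exp_lt_valuation_Δ _ (by rw [hval, WithZero.exp_lt_exp]; norm_num)
  have hΔK : (N.baseChange ℚ_[p]).Δ ≠ 0 := by
    rw [WeierstrassCurve.baseChange, WeierstrassCurve.map_Δ, hΔeq]
    exact (map_ne_zero_iff _ (IsFractionRing.injective ℤ_[p] ℚ_[p])).mpr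
      (mul_ne_zero (pow_ne_zero _ PadicInt.irreducible_p.ne_zero) hunit.ne_zero)
  exact ⟨hmin, (WeierstrassCurve.isElliptic_iff _).mpr (Ne.isUnit hΔK)⟩

/-- **`p ≥ 5`, `p ∤ u`, `u` a cubic NON-residue mod `p` ⇒ `c_p(y² = x³ + p³u) = 1`** (Step 6 with the
irreducible-over-`𝔽_p`-or-rootless cubic `T³ + u`: "`c = 1 + #{α ∈ k : P(α) = 0}`" with no root).
[cite: SilvermanATAEC1994, IV.9.4 Step 6 (PDF p. 345)] [cite: BoxerDiao2010, proof of Prop. 4.1 (p. 1977)] -/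
theorem localTamagawaNumber_cubeModel_padic_eq_one (hp2 : p ≠ 2) (hp3 : p ≠ 3) (hu : ¬ (p : ℤ) ∣ u)
    (hno : ∀ s : ZMod p, s ^ 3 ≠ (u : ZMod p)) :
    ((⟨0, 0, 0, 0, (p : ℤ_[p]) ^ 3 * (u : ℤ_[p])⟩ : WeierstrassCurve ℤ_[p]).baseChange
        ℚ_[p]).localTamagawaNumber ℤ_[p] = 1 := by
  obtain ⟨hmin, hell⟩ := isMinimal_cubeModel_padic hp2 hp3 hu
  haveI := hmin; haveI := hell
  refine LocalIndex.localTamagawaNumber_baseChange_eq_one_of_cubic_no_root _ (ϖ := (p : ℤ_[p]))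
    (α := 0) (β := 0) (γ := 0) (δ := 0) (ε := (u : ℤ_[p])) PadicInt.irreducible_p
    (by simp) (by simp) (by simp) (by simp) rfl fun t ht => ?_
  simp only [map_zero, zero_mul, add_zero] at ht
  -- `t³ = −ū`, so `(−t)³ = ū` in `ZMod p`
  have h3 : (-t) ^ 3 = residue ℤ_[p] (u : ℤ_[p]) := by
    linear_combination (-1 : ResidueField ℤ_[p]) * ht
  refine hno (PadicInt.residueField (-t)) ?_
  rw [← map_pow, h3, residueField_residue_intCast]

/-- **`p ≥ 5`, `p ∤ u`, `u` a CUBE mod `p` ⇒ `2 ∣ c_p(y² = x³ + p³u)`** (Step 6: the cubic `T³ + u` has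
the simple root `−s`, `s³ ≡ u`; Hensel lifts it and the bad point `(pT₀, 0)` has order `2` modulo
`E₀`; in fact `c_p ∈ {2, 4}`). [cite: SilvermanATAEC1994, IV.9.4 Step 6 (PDF p. 345)]
[cite: BoxerDiao2010, proof of Prop. 4.1 (p. 1977)] -/
theorem two_dvd_localTamagawaNumber_cubeModel_padic (hp2 : p ≠ 2) (hp3 : p ≠ 3)
    (hu : ¬ (p : ℤ) ∣ u) (hs : ∃ s : ZMod p, s ^ 3 = (u : ZMod p)) :
    2 ∣ ((⟨0, 0, 0, 0, (p : ℤ_[p]) ^ 3 * (u : ℤ_[p])⟩ : WeierstrassCurve ℤ_[p]).baseChange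
        ℚ_[p]).localTamagawaNumber ℤ_[p] := by
  haveI := henselianLocalRing_padicInt' (p := p)
  obtain ⟨hmin, hell⟩ := isMinimal_cubeModel_padic hp2 hp3 hu
  haveI := hmin; haveI := hell
  obtain ⟨s, hs⟩ := hs
  -- the root `t = −s` of `T³ + ū`, transported to the residue field of `ℤ_p`
  set t : ResidueField ℤ_[p] := (PadicInt.residueField (p := p)).symm (-s) with htdef
  have hφt : PadicInt.residueField t = -s := by rw [htdef, RingEquiv.apply_symm_apply]
  have ht : t ^ 3 + residue ℤ_[p] (u : ℤ_[p]) = 0 := by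
    apply (PadicInt.residueField (p := p)).injective
    rw [map_add, map_pow, hφt, residueField_residue_intCast, map_zero, neg_pow, ← hs]
    ring
  have h3 : (3 : ResidueField ℤ_[p]) ≠ 0 := by
    have h := intCast_residueField_ne_zero (p := p) (z := 3) fun h =>
      hp3 ((Nat.prime_dvd_prime_iff_eq hp.out Nat.prime_three).mp (by exact_mod_cast h))
    rw [Int.cast_ofNat, map_ofNat] at h
    exact h
  have ht0 : t ≠ 0 := by
    rintro h0
    rw [h0, zero_pow three_ne_zero, zero_add] at ht
    exact intCast_residueField_ne_zero hu ht
  refine LocalIndex.two_dvd_localTamagawaNumber_baseChange_of_cubic_simple_root _ (ϖ := (p : ℤ_[p]))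
    (α := 0) (β := 0) (γ := 0) (δ := 0) (ε := (u : ℤ_[p])) PadicInt.irreducible_p
    (by simp) (by simp) (by simp) (by simp) rfl (t := t) (by simpa using ht) ?_
  simp only [map_zero, mul_zero, zero_mul, add_zero]
  exact mul_ne_zero h3 (pow_ne_zero _ ht0)

end OddPrime

/-! ## §2 Over `ℤ₂`: the models `y² = x³ + 8u` (`u` odd) and `y² + 4y = x³ + 8w` (`w` odd) -/

section Two

variable {u w : ℤ}

/-- The residue of an odd integer in `𝔽₂ = ℤ₂/2ℤ₂` is `1`. [folklore] -/
private theorem residue_two_intCast_of_odd (hu : Odd u) : residue ℤ_[2] (u : ℤ_[2]) = 1 := by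
  obtain ⟨j, rfl⟩ := hu
  have h2 : residue ℤ_[2] (2 : ℤ_[2]) = 0 := by
    rw [residue_eq_zero_iff, PadicInt.maximalIdeal_eq_span_p, Ideal.mem_span_singleton]
    exact ⟨1, by simp⟩
  push_cast
  rw [map_add, map_mul, h2, zero_mul, zero_add, map_one]

/-- `3 ≠ 0` in `𝔽₂ = ℤ₂/2ℤ₂`. [folklore] -/
private theorem three_ne_zero_residue_two : (3 : ResidueField ℤ_[2]) ≠ 0 := by
  have h := intCast_residueField_ne_zero (p := 2) (z := 3) (by decide)
  rw [Int.cast_ofNat, map_ofNat] at h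
  exact h

/-- On the `2`-adic normal forms the Step-6 cubic is `T³ + 1`, with the SIMPLE root `T = 1` in `𝔽₂`
(`1 + 1 = 0`, `P'(1) = 3 = 1 ≠ 0`). [cite: SilvermanATAEC1994, IV.9.4 Step 6 (PDF p. 345)] -/
theorem cubic_two_simple_root_one (hw : Odd w) :
    (1 : ResidueField ℤ_[2]) ^ 3 + residue ℤ_[2] 0 * 1 ^ 2 + residue ℤ_[2] 0 * 1 +
        residue ℤ_[2] (w : ℤ_[2]) = 0 ∧
      3 * (1 : ResidueField ℤ_[2]) ^ 2 + 2 * residue ℤ_[2] 0 * 1 + residue ℤ_[2] 0 ≠ 0 := by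
  have h2 : (2 : ResidueField ℤ_[2]) = 0 := by
    have : residue ℤ_[2] (2 : ℤ_[2]) = 0 := by
      rw [residue_eq_zero_iff, PadicInt.maximalIdeal_eq_span_p, Ideal.mem_span_singleton]
      exact ⟨1, by simp⟩
    rw [map_ofNat] at this
    exact this
  refine ⟨?_, ?_⟩
  · rw [residue_two_intCast_of_odd hw, map_zero]
    have : (1 : ResidueField ℤ_[2]) ^ 3 + 0 * 1 ^ 2 + 0 * 1 + 1 = 2 := by ring
    rw [this, h2]
  · simp only [map_zero, mul_zero, add_zero, one_pow, mul_one]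
    exact three_ne_zero_residue_two

/-- `Δ(y² = x³ + 8u) = 2¹⁰ · (−27u²)` in `ℤ₂`. [cite: SilvermanAEC2009, III.1 (formula for Δ)] -/
theorem Δ_eightModel_padic (u : ℤ) :
    (⟨0, 0, 0, 0, ((8 * u : ℤ) : ℤ_[2])⟩ : WeierstrassCurve ℤ_[2]).Δ =
      (2 : ℤ_[2]) ^ 10 * ((-27 * u ^ 2 : ℤ) : ℤ_[2]) := by
  simp only [WeierstrassCurve.Δ, WeierstrassCurve.b₂, WeierstrassCurve.b₄, WeierstrassCurve.b₆,
    WeierstrassCurve.b₈]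
  push_cast; ring

/-- `Δ(y² + 4y = x³ + 8w) = 2⁸ · (−27(2w+1)²)` in `ℤ₂`. [cite: SilvermanAEC2009, III.1 (formula for Δ)] -/
theorem Δ_fourModel_padic (w : ℤ) :
    (⟨0, 0, ((4 : ℤ) : ℤ_[2]), 0, ((8 * w : ℤ) : ℤ_[2])⟩ : WeierstrassCurve ℤ_[2]).Δ =
      (2 : ℤ_[2]) ^ 8 * ((-27 * (2 * w + 1) ^ 2 : ℤ) : ℤ_[2]) := by
  simp only [WeierstrassCurve.Δ, WeierstrassCurve.b₂, WeierstrassCurve.b₄, WeierstrassCurve.b₆,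
    WeierstrassCurve.b₈]
  push_cast; ring

/-- `−27z²` is a `2`-adic unit for `z` odd. [folklore] -/
private theorem isUnit_neg27_mul_sq {z : ℤ} (hz : Odd z) : IsUnit (((-27 * z ^ 2 : ℤ)) : ℤ_[2]) := by
  refine isUnit_intCast_padicInt_of_not_dvd fun h => ?_
  have h' : (2 : ℤ) ∣ -27 * z ^ 2 := by exact_mod_cast h
  rcases (Int.prime_two.dvd_mul).mp h' with h | h
  · norm_num at h
  · exact (Int.not_even_iff_odd.mpr hz) (even_iff_two_dvd.mpr (Int.prime_two.dvd_of_dvd_pow h))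

/-- Minimality (`v(Δ) < 12`) and ellipticity of an explicit `ℤ₂`-model with `Δ = 2ⁿ·unit`, `n < 12`.
[cite: SilvermanAEC2009, VII.1 Remark 1.1] -/
theorem isMinimal_of_Δ_eq_two_pow_mul (N : WeierstrassCurve ℤ_[2]) {n : ℕ} {e : ℤ_[2]} (he : IsUnit e)
    (hΔ : N.Δ = (2 : ℤ_[2]) ^ n * e) (hn : n < 12) :
    (N.baseChange ℚ_[2]).IsMinimal ℤ_[2] ∧ (N.baseChange ℚ_[2]).IsElliptic := by
  haveI : WeierstrassCurve.IsIntegral ℤ_[2] (N.baseChange ℚ_[2]) := ⟨⟨_, rfl⟩⟩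
  have hirr : Irreducible (2 : ℤ_[2]) := by
    have := PadicInt.irreducible_p (p := 2); simpa using this
  have hval : (IsDiscreteValuationRing.maximalIdeal ℤ_[2]).valuation ℚ_[2] (N.baseChange ℚ_[2]).Δ =
      WithZero.exp (-(n : ℕ) : ℤ) := by
    rw [WeierstrassCurve.baseChange, WeierstrassCurve.map_Δ, hΔ]
    exact LocalIndex.valuation_algebraMap_pow_mul_of_isUnit hirr he n
  have hmin : (N.baseChange ℚ_[2]).IsMinimal ℤ_[2] :=
    WeierstrassCurve.isMinimal_of_exp_lt_valuation_Δ _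
      (by rw [hval, WithZero.exp_lt_exp]; omega)
  have hΔK : (N.baseChange ℚ_[2]).Δ ≠ 0 := by
    rw [WeierstrassCurve.baseChange, WeierstrassCurve.map_Δ, hΔ]
    exact (map_ne_zero_iff _ (IsFractionRing.injective ℤ_[2] ℚ_[2])).mpr
      (mul_ne_zero (pow_ne_zero _ hirr.ne_zero) he.ne_zero)
  exact ⟨hmin, (WeierstrassCurve.isElliptic_iff _).mpr (Ne.isUnit hΔK)⟩

/-- **`u` odd ⇒ `2 ∣ c₂(y² = x³ + 8u)`** (type `I₀*` at `2`, Step 6 on the equation itself: `ϖ = 2`,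
`a₆ = 2³u`, cubic `T³ + 1` with the simple root `1 ∈ 𝔽₂`; `v₂(Δ) = 10`).
[cite: SilvermanATAEC1994, IV.9.4 Step 6 (PDF p. 345)] [cite: BoxerDiao2010, proof of Prop. 4.1 (p. 1977)] -/
theorem two_dvd_localTamagawaNumber_eightModel_padic (hu : Odd u) :
    2 ∣ ((⟨0, 0, 0, 0, ((8 * u : ℤ) : ℤ_[2])⟩ : WeierstrassCurve ℤ_[2]).baseChange
        ℚ_[2]).localTamagawaNumber ℤ_[2] := by
  haveI := henselianLocalRing_padicInt' (p := 2)
  obtain ⟨hmin, hell⟩ := isMinimal_of_Δ_eq_two_pow_mul _ (isUnit_neg27_mul_sq hu)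
    (Δ_eightModel_padic u) (by norm_num)
  haveI := hmin; haveI := hell
  have hirr : Irreducible (2 : ℤ_[2]) := by
    have := PadicInt.irreducible_p (p := 2); simpa using this
  obtain ⟨ht, ht'⟩ := cubic_two_simple_root_one hu
  exact LocalIndex.two_dvd_localTamagawaNumber_baseChange_of_cubic_simple_root _ (ϖ := (2 : ℤ_[2]))
    (α := 0) (β := 0) (γ := 0) (δ := 0) (ε := (u : ℤ_[2])) hirr
    (by simp) (by simp) (by simp) (by simp)
    (by show (((8 * u : ℤ)) : ℤ_[2]) = 2 ^ 3 * (u : ℤ_[2]); push_cast; ring) ht ht'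

/-- **`w` odd ⇒ `2 ∣ c₂(y² + 4y = x³ + 8w)`** — the Step-6 normal form of `y² = x³ + 4u`,
`u = 2w + 1 ≡ 3 (mod 4)`, reached by `y ↦ y + 2` (`a₃ = 2²·1`, `a₆ = 2³·w`, cubic `T³ + 1` with the
simple root `1 ∈ 𝔽₂`; `v₂(Δ) = 8`). [cite: SilvermanATAEC1994, IV.9.4 Step 6 (PDF p. 345)]
[cite: BoxerDiao2010, proof of Prop. 4.1 (p. 1977)] -/
theorem two_dvd_localTamagawaNumber_fourModel_padic (hw : Odd w) :
    2 ∣ ((⟨0, 0, ((4 : ℤ) : ℤ_[2]), 0, ((8 * w : ℤ) : ℤ_[2])⟩ : WeierstrassCurve ℤ_[2]).baseChange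
        ℚ_[2]).localTamagawaNumber ℤ_[2] := by
  haveI := henselianLocalRing_padicInt' (p := 2)
  have hodd : Odd (2 * w + 1) := ⟨w, rfl⟩
  obtain ⟨hmin, hell⟩ := isMinimal_of_Δ_eq_two_pow_mul _ (isUnit_neg27_mul_sq hodd)
    (Δ_fourModel_padic w) (by norm_num)
  haveI := hmin; haveI := hell
  have hirr : Irreducible (2 : ℤ_[2]) := by
    have := PadicInt.irreducible_p (p := 2); simpa using this
  obtain ⟨ht, ht'⟩ := cubic_two_simple_root_one hw
  exact LocalIndex.two_dvd_localTamagawaNumber_baseChange_of_cubic_simple_root _ (ϖ := (2 : ℤ_[2]))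
    (α := 0) (β := 0) (γ := 1) (δ := 0) (ε := (w : ℤ_[2])) hirr
    (by simp) (by simp) (by show (((4 : ℤ)) : ℤ_[2]) = 2 ^ 2 * 1; norm_num) (by simp)
    (by show (((8 * w : ℤ)) : ℤ_[2]) = 2 ^ 3 * (w : ℤ_[2]); push_cast; ring) ht ht'

end Two

/-! ## §3 Transport to every model of `y² = x³ + k` over `ℚ`, `k = pᵃu` arbitrary -/

section Transport

variable (W : WeierstrassCurve ℚ) [W.IsElliptic] {C : VariableChange ℚ} {k : ℤ}

/-- Rescaling `(q^m, 0, 0, 0) • (y² = x³ + q^{6m}·b) = (y² = x³ + b)`. [folklore] -/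
private theorem powScale_smul {q : ℚ} (hq : q ≠ 0) (m : ℕ) (b : ℚ) :
    (⟨Units.mk0 (q ^ m) (pow_ne_zero _ hq), 0, 0, 0⟩ : VariableChange ℚ) •
        (⟨0, 0, 0, 0, q ^ (6 * m) * b⟩ : WeierstrassCurve ℚ) = ⟨0, 0, 0, 0, b⟩ := by
  have h6 : (q ^ m) ^ 6 = q ^ (6 * m) := by rw [← pow_mul, mul_comm]
  ext <;> simp [WeierstrassCurve.variableChange_a₁, WeierstrassCurve.variableChange_a₂,
    WeierstrassCurve.variableChange_a₃, WeierstrassCurve.variableChange_a₄,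
    WeierstrassCurve.variableChange_a₆]
  rw [h6, inv_mul_cancel_left₀ (pow_ne_zero _ hq)]

/-- `k = p^{6⌊a/6⌋} · (p^{a mod 6} · u)` with `a = v_p(k)`, `u = k / pᵃ` (`k ≠ 0`), `p ∤ u`, `u ≠ 0`.
[folklore] -/
private theorem exists_eq_pow_mul_of_ne_zero {p : ℕ} (hp : p.Prime) (hk : k ≠ 0) :
    let a := k.natAbs.factorization p
    (k : ℚ) = (p : ℚ) ^ (6 * (a / 6)) * (((p : ℤ) ^ (a % 6) * (k / (p : ℤ) ^ a) : ℤ) : ℚ) ∧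
      ¬ (p : ℤ) ∣ k / (p : ℤ) ^ a ∧ k / (p : ℤ) ^ a ≠ 0 := by
  intro a
  have hdvd : (p : ℤ) ^ a ∣ k := by
    have : ((p ^ a : ℕ) : ℤ) ∣ k := Int.natCast_dvd.mpr (Nat.ordProj_dvd k.natAbs p)
    exact_mod_cast this
  obtain ⟨u, hu⟩ := hdvd
  have hpa : (p : ℤ) ^ a ≠ 0 := pow_ne_zero _ (by exact_mod_cast hp.ne_zero)
  have hdiv : k / (p : ℤ) ^ a = u := by rw [hu]; exact Int.mul_ediv_cancel_left _ hpa
  have hu0 : u ≠ 0 := by rintro rfl; exact hk (by rw [hu, mul_zero])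
  have hup : ¬ (p : ℤ) ∣ u := by
    rintro ⟨w, rfl⟩
    have h1 : (p : ℤ) ^ (a + 1) ∣ k := ⟨w, by rw [hu]; ring⟩
    have h2 : p ^ (a + 1) ∣ k.natAbs := by
      have := Int.natAbs_dvd_natAbs.mpr h1
      rwa [Int.natAbs_pow, Int.natAbs_natCast] at this
    have := (hp.pow_dvd_iff_le_factorization (Int.natAbs_ne_zero.mpr hk)).mp h2
    change a + 1 ≤ a at this
    omega
  refine ⟨?_, by rwa [hdiv], by rwa [hdiv]⟩
  rw [hdiv, hu]
  push_cast
  rw [← mul_assoc, ← pow_add, Nat.div_add_mod]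

variable (p : ℕ) [hp : Fact p.Prime]

/-- **`c_p` of any model equals `c_p` of the Mordell equation** `C • W = (0,0,0,0,b)`: model
independence of the local Tamagawa number over `ℚ_p`. [cite: SilvermanAEC2009, VII.6 Ex. 7.6 with VII.1 Prop. 1.3(b)] -/
theorem localTamagawaNumber_padic_eq_of_smul_eq {M : WeierstrassCurve ℚ} (D : VariableChange ℚ)
    (hD : D • W = M) :
    (W.baseChange ℚ_[p]).localTamagawaNumber ℤ_[p] = (M.baseChange ℚ_[p]).localTamagawaNumber ℤ_[p] := by
  haveI : (W.baseChange ℚ_[p]).IsElliptic := by unfold WeierstrassCurve.baseChange; infer_instance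
  rw [← hD]
  unfold WeierstrassCurve.baseChange
  rw [← WeierstrassCurve.map_variableChange]
  exact (WeierstrassCurve.localTamagawaNumber_variableChange_holds ℤ_[p]
    (W.map (algebraMap ℚ ℚ_[p])) (D.map (algebraMap ℚ ℚ_[p]))).symm

/-- The rational Mordell equation over `ℚ_p` is the base change of the `ℤ_p`-model with the same
integer coefficient. [folklore] -/
private theorem baseChange_mordell_eq_padic (b : ℤ) :
    (⟨0, 0, 0, 0, (b : ℚ)⟩ : WeierstrassCurve ℚ).baseChange ℚ_[p] =
      (⟨0, 0, 0, 0, (b : ℤ_[p])⟩ : WeierstrassCurve ℤ_[p]).baseChange ℚ_[p] := by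
  ext <;> simp [WeierstrassCurve.baseChange, WeierstrassCurve.map]

/-- `c_p` of any model of `y² = x³ + k` is `c_p` of the REDUCED `ℤ_p`-model `y² = x³ + p^{a mod 6}u`
(`a = v_p(k)`, `u = k/pᵃ`): rescaling by `(p^{⌊a/6⌋}, 0, 0, 0)` and model independence.
[cite: SilvermanAEC2009, VII.6 Ex. 7.6 with VII.1 Prop. 1.3(b)] -/
theorem localTamagawaNumber_padic_eq_reduced (hM : C • W = ⟨0, 0, 0, 0, (k : ℚ)⟩) (hk : k ≠ 0) :
    (W.baseChange ℚ_[p]).localTamagawaNumber ℤ_[p] =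
      ((⟨0, 0, 0, 0, ((((p : ℤ) ^ (k.natAbs.factorization p % 6) *
          (k / (p : ℤ) ^ k.natAbs.factorization p) : ℤ)) : ℤ_[p])⟩ : WeierstrassCurve ℤ_[p]).baseChange
        ℚ_[p]).localTamagawaNumber ℤ_[p] := by
  obtain ⟨hkb, -, -⟩ := exists_eq_pow_mul_of_ne_zero hp.out hk
  set a := k.natAbs.factorization p with ha
  set b : ℤ := (p : ℤ) ^ (a % 6) * (k / (p : ℤ) ^ a) with hb
  have hp0 : (p : ℚ) ≠ 0 := by exact_mod_cast hp.out.ne_zero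
  set D : VariableChange ℚ := ⟨Units.mk0 ((p : ℚ) ^ (a / 6)) (pow_ne_zero _ hp0), 0, 0, 0⟩ with hD
  have hDM : (D * C) • W = ⟨0, 0, 0, 0, (b : ℚ)⟩ := by
    rw [mul_smul, hM, hkb, hD, powScale_smul hp0]
  rw [localTamagawaNumber_padic_eq_of_smul_eq W p (D * C) hDM, baseChange_mordell_eq_padic]

/-- **`p ≥ 5`, `v_p(k) ≡ 3 (mod 6)`, `u = k/p^{v_p(k)}` a cubic NON-residue mod `p` ⇒ `c_p(W) = 1`
for every model `W` of `y² = x³ + k`** (type `I₀*`, no `𝔽_p`-root of `T³ + u`).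
[cite: SilvermanATAEC1994, IV.9.4 Step 6 (PDF p. 345)] [cite: BoxerDiao2010, proof of Prop. 4.1 (p. 1977)] -/
theorem localTamagawaNumber_padic_mordell_eq_one_of_not_cube (hM : C • W = ⟨0, 0, 0, 0, (k : ℚ)⟩)
    (hk : k ≠ 0) (hp2 : p ≠ 2) (hp3 : p ≠ 3) (ha : k.natAbs.factorization p % 6 = 3)
    (hno : ∀ s : ZMod p, s ^ 3 ≠ ((k / (p : ℤ) ^ k.natAbs.factorization p : ℤ) : ZMod p)) :
    (W.baseChange ℚ_[p]).localTamagawaNumber ℤ_[p] = 1 := by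
  obtain ⟨-, hup, -⟩ := exists_eq_pow_mul_of_ne_zero hp.out hk
  rw [localTamagawaNumber_padic_eq_reduced W p hM hk, ha]
  push_cast
  exact localTamagawaNumber_cubeModel_padic_eq_one hp2 hp3 hup hno

/-- **`p ≥ 5`, `v_p(k) ≡ 3 (mod 6)`, `u = k/p^{v_p(k)}` a CUBE mod `p` ⇒ `2 ∣ c_p(W)` for every model
`W` of `y² = x³ + k`** (type `I₀*`, a simple `𝔽_p`-root of `T³ + u`; `c_p ∈ {2, 4}`).
[cite: SilvermanATAEC1994, IV.9.4 Step 6 (PDF p. 345)] [cite: BoxerDiao2010, proof of Prop. 4.1 (p. 1977)] -/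
theorem two_dvd_localTamagawaNumber_padic_mordell_of_cube (hM : C • W = ⟨0, 0, 0, 0, (k : ℚ)⟩)
    (hk : k ≠ 0) (hp2 : p ≠ 2) (hp3 : p ≠ 3) (ha : k.natAbs.factorization p % 6 = 3)
    (hs : ∃ s : ZMod p, s ^ 3 = ((k / (p : ℤ) ^ k.natAbs.factorization p : ℤ) : ZMod p)) :
    2 ∣ (W.baseChange ℚ_[p]).localTamagawaNumber ℤ_[p] := by
  obtain ⟨-, hup, -⟩ := exists_eq_pow_mul_of_ne_zero hp.out hk
  rw [localTamagawaNumber_padic_eq_reduced W p hM hk, ha]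
  push_cast
  exact two_dvd_localTamagawaNumber_cubeModel_padic hp2 hp3 hup hs

end Transport

section TransportTwo

variable (W : WeierstrassCurve ℚ) [W.IsElliptic] {C : VariableChange ℚ} {k : ℤ}

/-- An integer `u` with `2 ∤ u` is odd. [folklore] -/
private theorem odd_of_not_two_dvd {u : ℤ} (h : ¬ (2 : ℤ) ∣ u) : Odd u :=
  Int.not_even_iff_odd.mp fun he => h (even_iff_two_dvd.mp he)

/-- The rational equation `(0, 0, a₃, 0, a₆)` with integer coefficients over `ℚ₂` is the base change
of the `ℤ₂`-model with the same coefficients. [folklore] -/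
private theorem baseChange_intModel_eq_padic_two (a₃ a₆ : ℤ) :
    (⟨0, 0, (a₃ : ℚ), 0, (a₆ : ℚ)⟩ : WeierstrassCurve ℚ).baseChange ℚ_[2] =
      (⟨0, 0, (a₃ : ℤ_[2]), 0, (a₆ : ℤ_[2])⟩ : WeierstrassCurve ℤ_[2]).baseChange ℚ_[2] := by
  ext <;> simp [WeierstrassCurve.baseChange, WeierstrassCurve.map]

/-- **`v₂(k) ≡ 3 (mod 6)` ⇒ `2 ∣ c₂(W)` for every model `W` of `y² = x³ + k`** (type `I₀*` at `2`,
the cubic `T³ + 1` has the simple root `1 ∈ 𝔽₂`; indeed `c₂ = 2`).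
[cite: SilvermanATAEC1994, IV.9.4 Step 6 (PDF p. 345)] [cite: BoxerDiao2010, proof of Prop. 4.1 (p. 1977)] -/
theorem two_dvd_localTamagawaNumber_two_mordell_of_three (hM : C • W = ⟨0, 0, 0, 0, (k : ℚ)⟩)
    (hk : k ≠ 0) (ha : k.natAbs.factorization 2 % 6 = 3) :
    2 ∣ (W.baseChange ℚ_[2]).localTamagawaNumber ℤ_[2] := by
  haveI : Fact (Nat.Prime 2) := ⟨Nat.prime_two⟩
  obtain ⟨hkb, hup, -⟩ := exists_eq_pow_mul_of_ne_zero (k := k) Nat.prime_two hk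
  push_cast at hkb hup
  set a := k.natAbs.factorization 2 with hadef
  set u : ℤ := k / (2 : ℤ) ^ a with hudef
  have huodd : Odd u := odd_of_not_two_dvd hup
  have h20 : (2 : ℚ) ≠ 0 := two_ne_zero
  set D : VariableChange ℚ := ⟨Units.mk0 ((2 : ℚ) ^ (a / 6)) (pow_ne_zero _ h20), 0, 0, 0⟩ with hD
  have hk' : (k : ℚ) = (2 : ℚ) ^ (6 * (a / 6)) * (((8 * u : ℤ)) : ℚ) := by
    rw [hkb, ha]; push_cast; ring
  have hDM : (D * C) • W = ⟨0, 0, ((0 : ℤ) : ℚ), 0, (((8 * u : ℤ)) : ℚ)⟩ := by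
    rw [mul_smul, hM, hk', hD, powScale_smul h20]; push_cast; rfl
  rw [localTamagawaNumber_padic_eq_of_smul_eq W 2 _ hDM, baseChange_intModel_eq_padic_two,
    Int.cast_zero]
  exact two_dvd_localTamagawaNumber_eightModel_padic huodd

/-- `y ↦ y + 2` takes `y² = x³ + 4(2w+1)` to the Step-6 normal form `y² + 4y = x³ + 8w`.
[cite: SilvermanAEC2009, III.1 Table 3.1 (a₃ + 2t, a₆ − t a₃ − t²)] -/
theorem shiftTwo_smul (w : ℤ) :
    (⟨1, 0, 0, 2⟩ : VariableChange ℚ) •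
        (⟨0, 0, 0, 0, (((4 * (2 * w + 1) : ℤ)) : ℚ)⟩ : WeierstrassCurve ℚ) =
      ⟨0, 0, ((4 : ℤ) : ℚ), 0, (((8 * w : ℤ)) : ℚ)⟩ := by
  ext <;> simp [WeierstrassCurve.variableChange_a₁, WeierstrassCurve.variableChange_a₂,
    WeierstrassCurve.variableChange_a₃, WeierstrassCurve.variableChange_a₄,
    WeierstrassCurve.variableChange_a₆] <;> ring

/-- **`v₂(k) ≡ 2 (mod 6)` and `k/2^{v₂(k)} ≡ 3 (mod 4)` ⇒ `2 ∣ c₂(W)` for every model `W` of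
`y² = x³ + k`** (type `I₀*` at `2` on the normal form `y² + 4y = x³ + 8w`; indeed `c₂ = 2`).
[cite: SilvermanATAEC1994, IV.9.4 Step 6 (PDF p. 345)] [cite: BoxerDiao2010, proof of Prop. 4.1 (p. 1977)] -/
theorem two_dvd_localTamagawaNumber_two_mordell_of_two (hM : C • W = ⟨0, 0, 0, 0, (k : ℚ)⟩)
    (hk : k ≠ 0) (ha : k.natAbs.factorization 2 % 6 = 2)
    (hu : k / (2 : ℤ) ^ k.natAbs.factorization 2 % 4 = 3) :
    2 ∣ (W.baseChange ℚ_[2]).localTamagawaNumber ℤ_[2] := by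
  haveI : Fact (Nat.Prime 2) := ⟨Nat.prime_two⟩
  obtain ⟨hkb, hup, -⟩ := exists_eq_pow_mul_of_ne_zero (k := k) Nat.prime_two hk
  push_cast at hkb hup
  set a := k.natAbs.factorization 2 with hadef
  -- `u = k/2ᵃ = 2w + 1` with `w` odd
  obtain ⟨w, hw⟩ : ∃ w : ℤ, k / (2 : ℤ) ^ a = 2 * w + 1 := ⟨k / (2 : ℤ) ^ a / 2, by omega⟩
  have hwodd : Odd w := Int.odd_iff.mpr (by omega)
  have h20 : (2 : ℚ) ≠ 0 := two_ne_zero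
  set D : VariableChange ℚ := ⟨Units.mk0 ((2 : ℚ) ^ (a / 6)) (pow_ne_zero _ h20), 0, 0, 0⟩ with hD
  have hk' : (k : ℚ) = (2 : ℚ) ^ (6 * (a / 6)) * (((4 * (2 * w + 1) : ℤ)) : ℚ) := by
    rw [hkb, ha, hw]; push_cast; ring
  -- `W ≅ (y² = x³ + 4u) ≅ (y² + 4y = x³ + 8w)`
  have hDM : (⟨1, 0, 0, 2⟩ * D * C) • W = ⟨0, 0, ((4 : ℤ) : ℚ), 0, (((8 * w : ℤ)) : ℚ)⟩ := by
    rw [mul_smul, mul_smul, hM, hk', hD, powScale_smul h20, shiftTwo_smul]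
  rw [localTamagawaNumber_padic_eq_of_smul_eq W 2 _ hDM, baseChange_intModel_eq_padic_two]
  exact two_dvd_localTamagawaNumber_fourModel_padic hwodd

end TransportTwo

/-! ## §4 The same at the places of `ℚ` (the currency of `W.tamagawaProduct`) -/

section Places

variable (W : WeierstrassCurve ℚ) [W.IsElliptic] {C : VariableChange ℚ} {k : ℤ}
  (v : HeightOneSpectrum (𝓞 ℚ))

/-- **At a place `v ∣ p`, `p ≥ 5`, with `v_p(k) ≡ 3 (mod 6)`: `c_v(W) = 1` iff `u = k/p^{v_p(k)}` is a
cubic non-residue mod `p` — the "no root" half** (every model `W` of `y² = x³ + k`).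
[cite: SilvermanATAEC1994, IV.9.4 Step 6 (PDF p. 345)] [cite: BoxerDiao2010, proof of Prop. 4.1 (p. 1977)] -/
theorem localTamagawaNumber_mordell_eq_one_of_not_cube (hM : C • W = ⟨0, 0, 0, 0, (k : ℚ)⟩)
    (hk : k ≠ 0) (h2 : natGenerator v ≠ 2) (h3 : natGenerator v ≠ 3)
    (ha : k.natAbs.factorization (natGenerator v) % 6 = 3)
    (hno : ∀ s : ZMod (natGenerator v),
      s ^ 3 ≠ ((k / (natGenerator v : ℤ) ^ k.natAbs.factorization (natGenerator v) : ℤ) :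
        ZMod (natGenerator v))) :
    (W.baseChange (v.adicCompletion ℚ)).localTamagawaNumber (v.adicCompletionIntegers ℚ) = 1 := by
  haveI : Fact (Nat.Prime (natGenerator v)) := ⟨prime_natGenerator v⟩
  rw [← WeierstrassCurve.localTamagawaNumber_padic_eq_holds W v (natGenerator v) rfl]
  exact localTamagawaNumber_padic_mordell_eq_one_of_not_cube W (natGenerator v) hM hk h2 h3 ha hno

/-- **At a place `v ∣ p`, `p ≥ 5`, with `v_p(k) ≡ 3 (mod 6)` and `u = k/p^{v_p(k)}` a cube mod `p`:
`c_v(W)` is EVEN** (every model `W` of `y² = x³ + k`).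
[cite: SilvermanATAEC1994, IV.9.4 Step 6 (PDF p. 345)] [cite: BoxerDiao2010, proof of Prop. 4.1 (p. 1977)] -/
theorem two_dvd_localTamagawaNumber_mordell_of_cube (hM : C • W = ⟨0, 0, 0, 0, (k : ℚ)⟩)
    (hk : k ≠ 0) (h2 : natGenerator v ≠ 2) (h3 : natGenerator v ≠ 3)
    (ha : k.natAbs.factorization (natGenerator v) % 6 = 3)
    (hs : ∃ s : ZMod (natGenerator v),
      s ^ 3 = ((k / (natGenerator v : ℤ) ^ k.natAbs.factorization (natGenerator v) : ℤ) :
        ZMod (natGenerator v))) :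
    2 ∣ (W.baseChange (v.adicCompletion ℚ)).localTamagawaNumber (v.adicCompletionIntegers ℚ) := by
  haveI : Fact (Nat.Prime (natGenerator v)) := ⟨prime_natGenerator v⟩
  rw [← WeierstrassCurve.localTamagawaNumber_padic_eq_holds W v (natGenerator v) rfl]
  exact two_dvd_localTamagawaNumber_padic_mordell_of_cube W (natGenerator v) hM hk h2 h3 ha hs

/-- **At the place `v ∣ 2`, with `v₂(k) ≡ 3 (mod 6)`: `c_v(W)` is EVEN** (every model `W` of
`y² = x³ + k`). [cite: SilvermanATAEC1994, IV.9.4 Step 6 (PDF p. 345)]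
[cite: BoxerDiao2010, proof of Prop. 4.1 (p. 1977)] -/
theorem two_dvd_localTamagawaNumber_mordell_two_of_three (hM : C • W = ⟨0, 0, 0, 0, (k : ℚ)⟩)
    (hk : k ≠ 0) (hv : natGenerator v = 2) (ha : k.natAbs.factorization 2 % 6 = 3) :
    2 ∣ (W.baseChange (v.adicCompletion ℚ)).localTamagawaNumber (v.adicCompletionIntegers ℚ) := by
  haveI : Fact (Nat.Prime 2) := ⟨Nat.prime_two⟩
  rw [← WeierstrassCurve.localTamagawaNumber_padic_eq_holds W v 2 hv]
  exact two_dvd_localTamagawaNumber_two_mordell_of_three W hM hk ha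

/-- **At the place `v ∣ 2`, with `v₂(k) ≡ 2 (mod 6)` and `k/2^{v₂(k)} ≡ 3 (mod 4)`: `c_v(W)` is
EVEN** (every model `W` of `y² = x³ + k`). [cite: SilvermanATAEC1994, IV.9.4 Step 6 (PDF p. 345)]
[cite: BoxerDiao2010, proof of Prop. 4.1 (p. 1977)] -/
theorem two_dvd_localTamagawaNumber_mordell_two_of_two (hM : C • W = ⟨0, 0, 0, 0, (k : ℚ)⟩)
    (hk : k ≠ 0) (hv : natGenerator v = 2) (ha : k.natAbs.factorization 2 % 6 = 2)
    (hu : k / (2 : ℤ) ^ k.natAbs.factorization 2 % 4 = 3) :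
    2 ∣ (W.baseChange (v.adicCompletion ℚ)).localTamagawaNumber (v.adicCompletionIntegers ℚ) := by
  haveI : Fact (Nat.Prime 2) := ⟨Nat.prime_two⟩
  rw [← WeierstrassCurve.localTamagawaNumber_padic_eq_holds W v 2 hv]
  exact two_dvd_localTamagawaNumber_two_mordell_of_two W hM hk ha hu

end Places

end Literature.NumberTheory.EllipticCurves.Mordell

end
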